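import Literature.NumberTheory.LFunctions.ExceptionalZeroLogDerivOne
import Literature.NumberTheory.LFunctions.RHWave0
import HarnessLib

/-!
# Siegel zeros and the size of `L'/L(1, χ)`: the Mahler–Granville–Stark criterion

Topic `Literature/NumberTheory/LFunctions`. Everything in this file is PROVED (theorems only, no
definitions, no named facts).

Granville–Stark (*Invent. Math.* 139 (2000), §1 and §3.1, Remark 1) reduce "no Siegel zeros for
`L(s, (−d/·))`" to an upper bound `L'/L(1, χ_{−d}) ≪ log d`: by Montgomery–Vaughan's Lemma 11.1 and
Theorem 11.3, `L'/L(1, χ) = 1/(1 − β) + O(log q)` where `β` is the exceptional zero if it exists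
(loc. cit., Remark 1: "This estimate, combined with Theorem 3, implies Mahler's result"), so a real
zero `β > 1 − c/log q` forces `L'/L(1, χ) ≥ (1/c − O(1)) log q`. Conversely, if `L(s, χ)` has no
real zero in `1 − c/log q < s < 1`, then every zero near `1` is at horizontal distance `≫ 1/log q`
from `σ = 1` (MV Theorem 11.3 for the complex ones) and the same partial-fraction formula gives
`|L'/L(1, χ)| ≪ (1 + 1/c) log q`. Táfula (*Acta Arith.* 201 (2021), p. 3) records the resulting
equivalence: "`|L'/L(1, χ_D)| ≪ log |D|`, which is equivalent to `L(s, χ_D)` having no Siegel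
zeros".

We prove, for quadratic characters `χ ≠ χ₀` (`χ² = χ₀`) modulo `q ≥ 2`, with ABSOLUTE constants:

* `eta_le_of_logDeriv_le` — if `L'(1, χ) ≤ A log q · L(1, χ)` and `β₁ = 1 − 1/(η log q)` is a zero
  with `η ≥ η₀`, then `η ≤ A + C` (from the tree's
  `Literature.NumberTheory.LFunctions.ExceptionalZero.exists_abs_sub_le_div_eta`:
  `|(1 − β₁) L'(1, χ) − L(1, χ)| ≤ (C/η) L(1, χ)`);
* `exists_LFunction_ne_zero_of_logDeriv_le` — **the criterion**: there is an absolute `C₀ > 0` such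
  that `L'(1, χ) ≤ A log q · L(1, χ)` (`A ≥ 0`) implies `L(σ, χ) ≠ 0` for all real
  `σ > 1 − 1/((A + C₀) log q)`;
* `exists_logDeriv_le_of_LFunction_ne_zero` — **the converse**: there are absolute `A₁, A₂` such
  that if `L(σ, χ) ≠ 0` on `1 − c/log q < σ < 1` (`0 < c ≤ 1`) then
  `Re L'/L(1, χ) ≤ (A₁ + A₂/c) log q`; and `neg_logDeriv_one_le`: `Re L'/L(1, χ) ≥ −A₁ log q`
  unconditionally (every non-principal `χ`);
* the packaged forms for the tree's statement `Literature.NumberTheory.LFunctions.NoSiegelZeros`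
  (rh.S34, all real primitive `χ` mod `q ≥ 3`): `noSiegelZeros_of_logDeriv_le`,
  `noSiegelZeros_iff_logDeriv_le`, and the "sufficiently large `q`" version
  `noSiegelZeros_of_eventually_logDeriv_le` (finitely many small moduli are absorbed into the
  constant, `exists_forall_lt_logDeriv_le`). The odd-character forms, for the consequent
  `Literature.NumberTheory.DiophantineGeometry.NoSiegelZerosOddQuadratic` of Granville–Stark's
  Theorem 2, live next to that statement in
  `Literature/NumberTheory/DiophantineGeometry/AbcWave0GranvilleStarkProofs.lean`, which is the form
  in which Granville–Stark's Theorem 1 + Theorem 3 feed Theorem 2.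

## Mathlib / tree search

Tree: `ExceptionalZero.exists_abs_sub_le_div_eta`, `LFunction_one_re_pos_im_zero`,
`deriv_LFunction_ofReal_im_eq_zero`, `re_sum_erase_le`, `re_div_sub_nonneg`, `logDeriv_one_add_eq`,
`one_add_mem_closedBall` (`ExceptionalZeroLogDerivOne.lean`); `DirichletZFR.exists_logDeriv_package`,
`exists_norm_logDeriv_le`, `exists_zeroFree` (MV §11.1). Mathlib: `DirichletCharacter.LFunction`,
`LFunction_ne_zero_of_one_le_re`, `MulChar.IsQuadratic.sq_eq_one`, `MulChar.finite`,
`DirichletCharacter.eq_one_iff_conductor_eq_one` (a primitive character mod `q ≥ 2` is not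
principal; inlined, as the tree's `Literature.Barriers.Parity.ne_one_of_isPrimitive` lives in a
`Barriers/` file). Searched
`Siegel`, `logDeriv.*one`, `NoSiegelZeros`: the only existing implication into `NoSiegelZeros` is
the Chowla-induced-character one of
`Literature/Barriers/RiemannHypothesis/FeketePolyaPositivityChowlaStatus.lean`.

## References

* [GranvilleStark2000] A. Granville, H. M. Stark, *ABC implies no "Siegel zeros" for L-functions of
  characters with negative discriminant*, Invent. Math. 139 (2000), 509–523: §1 (p. 510–511,
  "Mahler [11] showed that if (2) holds then … no real zero in the interval `1 − c/log d < s ≤ 1`"),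
  §3.1 Remark 1 (p. 515, `L'/L(1, χ) = 1/(1 − β) + O(log d)`).
* [MontgomeryVaughan2007] H. L. Montgomery, R. C. Vaughan, *Multiplicative Number Theory I*, CUP
  2007, §11.1 Lemma 11.1, Theorem 11.3.
* [Tafula2021] C. Táfula, *On Landau–Siegel zeros and heights of singular moduli*, Acta Arith. 201
  (2021), 1–28, p. 3.
* K. Mahler, *On Hecke's theorem on the real zeros of the L-functions and the class number of
  quadratic fields*, J. London Math. Soc. 9 (1934), 298–302 (cited through [GranvilleStark2000]).
-/

noncomputable section

open Complex Filter Topology Metric Set Finset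

namespace Literature.NumberTheory.LFunctions.ExceptionalZero

open Literature.NumberTheory.LFunctions.DirichletZFR

/-! ## Elementary facts on quadratic characters and `L'/L(1, χ)` -/

/-- For a quadratic `χ ≠ χ₀`, `L(1, χ)` and `L'(1, χ)` are real, so
`Re (L'(1, χ)/L(1, χ)) = Re L'(1, χ) / Re L(1, χ)`. [folklore] -/
theorem logDeriv_one_re_eq_div {q : ℕ} [NeZero q] (χ : DirichletCharacter ℂ q) (hχ : χ ≠ 1)
    (hχ2 : χ ^ 2 = 1) :
    (deriv χ.LFunction 1 / χ.LFunction 1).re =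
      (deriv χ.LFunction 1).re / (χ.LFunction 1).re := by
  have hone : ((1 : ℝ) : ℂ) = 1 := by simp
  obtain ⟨-, hL1im⟩ := LFunction_one_re_pos_im_zero χ hχ hχ2
  have hL'im : (deriv χ.LFunction 1).im = 0 := by
    have := deriv_LFunction_ofReal_im_eq_zero χ hχ hχ2 (σ := 1) one_pos
    rwa [hone] at this
  obtain ⟨a, ha⟩ : ∃ a : ℝ, χ.LFunction 1 = a :=
    ⟨(χ.LFunction 1).re, by apply Complex.ext <;> simp [hL1im]⟩
  obtain ⟨b, hb⟩ : ∃ b : ℝ, deriv χ.LFunction 1 = b :=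
    ⟨(deriv χ.LFunction 1).re, by apply Complex.ext <;> simp [hL'im]⟩
  rw [ha, hb, ← Complex.ofReal_div, Complex.ofReal_re, Complex.ofReal_re, Complex.ofReal_re]

/-- Reformulation of `Re L'/L(1, χ) ≤ A log q` as `Re L'(1, χ) ≤ A log q · Re L(1, χ)` for a
quadratic `χ ≠ χ₀` (`L(1, χ) > 0`). [folklore] -/
theorem deriv_re_le_of_logDeriv_re_le {q : ℕ} [NeZero q] (χ : DirichletCharacter ℂ q) (hχ : χ ≠ 1)
    (hχ2 : χ ^ 2 = 1) {B : ℝ} (h : (deriv χ.LFunction 1 / χ.LFunction 1).re ≤ B) :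
    (deriv χ.LFunction 1).re ≤ B * (χ.LFunction 1).re := by
  obtain ⟨hL1pos, -⟩ := LFunction_one_re_pos_im_zero χ hχ hχ2
  rw [logDeriv_one_re_eq_div χ hχ hχ2, div_le_iff₀ hL1pos] at h
  exact h

/-! ## From `L'/L(1, χ) ≪ log q` to a zero-free interval -/

/-- **Quality bound.** With the absolute constants `C, η₀` of
`ExceptionalZero.exists_abs_sub_le_div_eta`: if `χ ≠ χ₀` is quadratic mod `q ≥ 2`,
`Re L'(1, χ) ≤ A log q · Re L(1, χ)` with `A ≥ 0`, and `β₁ = 1 − 1/(η log q)` is a zero of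
`L(s, χ)` with `η ≥ η₀`, then `η ≤ A + C`. Indeed `L(1) − (1 − β₁) L'(1) ≤ (C/η) L(1)` and
`(1 − β₁) L'(1) ≤ (A/η) L(1)`, so `1 − A/η ≤ C/η` as `L(1, χ) > 0`.
[cite: GranvilleStark2000, §3.1 Remark 1] -/
theorem eta_le_of_logDeriv_le :
    ∃ C η₀ : ℝ, 0 < C ∧ 0 < η₀ ∧ ∀ (A : ℝ), 0 ≤ A → ∀ (q : ℕ) [NeZero q] (χ : DirichletCharacter ℂ q),
      χ ≠ 1 → χ ^ 2 = 1 → 2 ≤ q →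
        (deriv χ.LFunction 1).re ≤ A * Real.log q * (χ.LFunction 1).re →
          ∀ η : ℝ, η₀ ≤ η → χ.LFunction ((1 - 1 / (η * Real.log q) : ℝ) : ℂ) = 0 → η ≤ A + C := by
  obtain ⟨C, η₀, hC, hη₀, H⟩ := exists_abs_sub_le_div_eta
  refine ⟨C, η₀, hC, hη₀, fun A hA q _ χ hχ hχ2 hq hD η hη hzero ↦ ?_⟩
  have h := H q χ hχ hχ2 hq η hη hzero
  obtain ⟨hL1pos, -⟩ := LFunction_one_re_pos_im_zero χ hχ hχ2
  set L : ℝ := (χ.LFunction 1).re with hLdef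
  set D : ℝ := (deriv χ.LFunction 1).re with hDdef
  have hq2 : (2 : ℝ) ≤ q := by exact_mod_cast hq
  have hLq0 : 0 < Real.log q := by
    have := Real.log_le_log two_pos hq2
    linarith [Real.log_two_gt_d9]
  have hη0 : 0 < η := lt_of_lt_of_le hη₀ hη
  have hηL : 0 < η * Real.log q := mul_pos hη0 hLq0
  -- `L − (1/(η log q)) D ≤ (C/η) L`
  have h1 : L - 1 / (η * Real.log q) * D ≤ C / η * L := by
    have := neg_abs_le (1 / (η * Real.log q) * D - L)
    linarith
  -- `(1/(η log q)) D ≤ (A/η) L`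
  have h2 : 1 / (η * Real.log q) * D ≤ A / η * L := by
    calc 1 / (η * Real.log q) * D ≤ 1 / (η * Real.log q) * (A * Real.log q * L) :=
          mul_le_mul_of_nonneg_left hD (by positivity)
      _ = A / η * L := by field_simp
  have h3 : L - A / η * L ≤ C / η * L := by linarith
  have h4 : 1 - A / η ≤ C / η := by
    have h3' : (1 - A / η) * L ≤ (C / η) * L := by linarith
    exact le_of_mul_le_mul_right h3' hL1pos
  have h5 : η - A ≤ C := by
    have := mul_le_mul_of_nonneg_right h4 hη0.le
    rwa [sub_mul, one_mul, div_mul_cancel₀ _ hη0.ne', div_mul_cancel₀ _ hη0.ne'] at this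
  linarith

/-- **The Mahler–Granville–Stark criterion: `L'/L(1, χ) ≪ log q` excludes Siegel zeros.** There is
an absolute constant `C₀ > 0` such that for every `A ≥ 0`, every `q ≥ 2` and every quadratic
character `χ ≠ χ₀` mod `q` with `Re L'(1, χ) ≤ A log q · Re L(1, χ)` (i.e. `L'/L(1, χ) ≤ A log q`),
`L(σ, χ) ≠ 0` for all real `σ > 1 − 1/((A + C₀) log q)`. (For `σ ≥ 1` this is Mathlib's
non-vanishing on `Re s ≥ 1`; for `σ < 1` write `σ = 1 − 1/(η log q)` with `η > A + C₀ ≥ η₀` and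
apply `eta_le_of_logDeriv_le`.) Granville–Stark, §1: "Mahler [11] showed that if (2) holds then the
Dirichlet L-function `L(s, χ_d)` … has no real zero in the interval `1 − c/log d < s ≤ 1`, for some
sufficiently small constant `c > 0`", via §3.1 Remark 1.
[cite: GranvilleStark2000, §1 (Theorem 2) and §3.1 Remark 1] -/
theorem exists_LFunction_ne_zero_of_logDeriv_le :
    ∃ C₀ : ℝ, 0 < C₀ ∧ ∀ (A : ℝ), 0 ≤ A → ∀ (q : ℕ) [NeZero q] (χ : DirichletCharacter ℂ q),
      χ ≠ 1 → χ ^ 2 = 1 → 2 ≤ q →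
        (deriv χ.LFunction 1).re ≤ A * Real.log q * (χ.LFunction 1).re →
          ∀ σ : ℝ, 1 - 1 / ((A + C₀) * Real.log q) < σ → χ.LFunction σ ≠ 0 := by
  obtain ⟨C, η₀, hC, hη₀, H⟩ := eta_le_of_logDeriv_le
  refine ⟨C + η₀, by positivity, fun A hA q _ χ hχ hχ2 hq hD σ hσ hzero ↦ ?_⟩
  have hq2 : (2 : ℝ) ≤ q := by exact_mod_cast hq
  have hLq0 : 0 < Real.log q := by
    have := Real.log_le_log two_pos hq2
    linarith [Real.log_two_gt_d9]
  rcases le_or_gt 1 σ with h1σ | hσ1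
  · exact DirichletCharacter.LFunction_ne_zero_of_one_le_re χ (Or.inl hχ)
      (by simpa using h1σ) hzero
  -- `σ = 1 − 1/(η log q)` with `η = 1/((1 − σ) log q)`
  set η : ℝ := 1 / ((1 - σ) * Real.log q) with hηdef
  have h1σ0 : 0 < 1 - σ := by linarith
  have hη0 : 0 < η := by positivity
  have hσeq : σ = 1 - 1 / (η * Real.log q) := by
    rw [hηdef]; field_simp; ring
  -- `η > A + C + η₀`
  have hη1 : A + (C + η₀) < η := by
    have hpos : 0 < A + (C + η₀) := by positivity
    have hlt : 1 - σ < 1 / ((A + (C + η₀)) * Real.log q) := by linarith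
    have hlt' : (1 - σ) * ((A + (C + η₀)) * Real.log q) < 1 := (lt_div_iff₀ (by positivity)).mp hlt
    rw [hηdef, lt_div_iff₀ (mul_pos h1σ0 hLq0)]
    calc (A + (C + η₀)) * ((1 - σ) * Real.log q) = (1 - σ) * ((A + (C + η₀)) * Real.log q) := by
          ring
      _ < 1 := hlt'
  have hηη₀ : η₀ ≤ η := by linarith [hC]
  have hzero' : χ.LFunction ((1 - 1 / (η * Real.log q) : ℝ) : ℂ) = 0 := by rwa [← hσeq]
  have := H A hA q χ hχ hχ2 hq hD η hηη₀ hzero'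
  linarith

/-! ## The converse: a zero-free interval bounds `L'/L(1, χ)` -/

/-- **`Re L'/L(1, χ) ≥ −A₁ log q` for every non-principal `χ` mod `q ≥ 2`**: in the partial-fraction
formula `L'/L(1, χ) = ψ(1) + ∑_{a} m(a)/(1 − a)` of MV Lemma 11.1 every term of the sum has
non-negative real part and `|ψ(1)| ≤ E (log q + log 4)`. [cite: MontgomeryVaughan2007, Lemma 11.1] -/
theorem neg_logDeriv_one_le :
    ∃ A₁ : ℝ, 0 < A₁ ∧ ∀ (q : ℕ) [NeZero q] (χ : DirichletCharacter ℂ q), χ ≠ 1 → 2 ≤ q →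
      -(A₁ * Real.log q) ≤ (deriv χ.LFunction 1 / χ.LFunction 1).re := by
  obtain ⟨E, hE, hpackage⟩ := exists_logDeriv_package
  refine ⟨3 * E + 1, by positivity, fun q _ χ hχ hq ↦ ?_⟩
  have hq2 : (2 : ℝ) ≤ q := by exact_mod_cast hq
  have hLq2 : Real.log 2 ≤ Real.log q := Real.log_le_log two_pos hq2
  have hLq0 : 0 < Real.log q := by linarith [Real.log_two_gt_d9]
  have hlog4 : Real.log 4 = 2 * Real.log 2 := by
    rw [show (4 : ℝ) = 2 ^ 2 by norm_num, Real.log_pow]; ring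
  obtain ⟨S, m, ψ, hS, -, hψ, hψb⟩ := hpackage q χ hχ 0
  have hcen : (17 / 16 + ((0 : ℝ) : ℂ) * I : ℂ) = (17 / 16 : ℂ) := by simp
  simp only [hcen, abs_zero, zero_add] at hS hψ hψb
  have hone : ((1 : ℝ) : ℂ) = 1 := by simp
  have hid : deriv χ.LFunction 1 / χ.LFunction 1 = ψ 1 + ∑ a ∈ S, (m a : ℂ) / (1 - a) := by
    have h := logDeriv_one_add_eq χ hχ hψ (u := 0) le_rfl (by norm_num)
    simpa only [add_zero, hone] using h
  have hsum0 : 0 ≤ (∑ a ∈ S, (m a : ℂ) / (1 - a)).re := by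
    rw [Complex.re_sum]
    refine sum_nonneg fun a ha ↦ re_div_sub_nonneg ?_
    simp only [Complex.one_re]
    exact re_lt_one_of_zero χ hχ (hS a ha).1
  have hψ1 : |(ψ 1).re| ≤ E * (Real.log q + Real.log 4) := by
    have := (Complex.abs_re_le_norm _).trans
      (hψb _ (one_add_mem_closedBall (u := 0) le_rfl (by norm_num)))
    simpa only [add_zero, hone] using this
  have hEℒ : E * (Real.log q + Real.log 4) ≤ 3 * E * Real.log q := by
    have : Real.log q + Real.log 4 ≤ 3 * Real.log q := by rw [hlog4]; linarith
    calc E * (Real.log q + Real.log 4) ≤ E * (3 * Real.log q) := mul_le_mul_of_nonneg_left this hE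
      _ = 3 * E * Real.log q := by ring
  rw [hid, Complex.add_re]
  have := neg_abs_le (ψ 1).re
  nlinarith

/-- **The converse of the criterion: no real zero in `(1 − c/log q, 1)` implies
`Re L'/L(1, χ) ≤ (A₁ + A₂/c) log q`** (absolute `A₁, A₂`; quadratic `χ ≠ χ₀` mod `q ≥ 2`,
`0 < c ≤ 1`). By MV Lemma 11.1, `L'/L(1, χ) = ψ(1) + ∑_a m(a)/(1 − a)` over the zeros `a` with
`|a − 17/16| ≤ 13/32`; complex zeros there have `1 − Re a ≥ c_Z/(log q + log 5)` (MV Theorem 11.3,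
`DirichletZFR.exists_zeroFree`) and real ones have `1 − a ≥ c/log q` by hypothesis, so
`∑_a m(a) Re 1/(1 − a) ≤ 2(1/κ + K₀ + E(log q + log 4))` with `κ = min(c_Z, c, 1/8)/(log q + log 5)`
(`re_sum_erase_le`). Granville–Stark §3.1 Remark 1 / Táfula p. 3 ("equivalent to `L(s, χ_D)` having
no Siegel zeros"). [cite: GranvilleStark2000, §3.1 Remark 1] -/
theorem exists_logDeriv_le_of_LFunction_ne_zero :
    ∃ A₁ A₂ : ℝ, 0 < A₁ ∧ 0 < A₂ ∧ ∀ (c : ℝ), 0 < c → c ≤ 1 →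
      ∀ (q : ℕ) [NeZero q] (χ : DirichletCharacter ℂ q), χ ≠ 1 → 2 ≤ q →
        (∀ σ : ℝ, 1 - c / Real.log q < σ → σ < 1 → χ.LFunction σ ≠ 0) →
          (deriv χ.LFunction 1 / χ.LFunction 1).re ≤ (A₁ + A₂ / c) * Real.log q := by
  obtain ⟨K₀, hK₀, hK, hKχ⟩ := exists_norm_logDeriv_le
  obtain ⟨E, hE, hpackage⟩ := exists_logDeriv_package
  obtain ⟨cZ, hcZ, hZF⟩ := exists_zeroFree
  -- `c' = min (min cZ c) (1/8)`; `1/c' ≤ 1/cZ + 1/c + 8`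
  refine ⟨9 * E + 4 * K₀ + 8 / cZ + 64 + 1, 8, by positivity, by norm_num,
    fun c hc hc1 q _ χ hχ hq hfree ↦ ?_⟩
  have hq2 : (2 : ℝ) ≤ q := by exact_mod_cast hq
  set Lq : ℝ := Real.log q with hLq
  have hLq2 : Real.log 2 ≤ Lq := Real.log_le_log two_pos hq2
  have hLq0 : 0 < Lq := by linarith [Real.log_two_gt_d9]
  have h2Lq : 1 ≤ 2 * Lq := by linarith [Real.log_two_gt_d9]
  have hlog4 : Real.log 4 = 2 * Real.log 2 := by
    rw [show (4 : ℝ) = 2 ^ 2 by norm_num, Real.log_pow]; ring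
  have hlog5 : Real.log 5 ≤ 3 * Real.log 2 := by
    rw [← Real.log_rpow two_pos, show (2 : ℝ) ^ (3 : ℝ) = 8 by norm_num]
    exact Real.log_le_log (by norm_num) (by norm_num)
  have hlog45 : Real.log 4 ≤ Real.log 5 := Real.log_le_log (by norm_num) (by norm_num)
  set ℒ : ℝ := Lq + Real.log 4 with hℒdef
  have hℒ3 : ℒ ≤ 3 * Lq := by rw [hℒdef]; linarith
  set ℒ₅ : ℝ := Lq + Real.log 5 with hℒ₅def
  have hℒ₅4 : ℒ₅ ≤ 4 * Lq := by rw [hℒ₅def]; linarith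
  have hℒ₅1 : 1 ≤ ℒ₅ := by
    rw [hℒ₅def]
    have h5 : (1 : ℝ) ≤ Real.log 5 := by
      rw [Real.le_log_iff_exp_le (by norm_num)]
      exact le_trans (le_of_lt Real.exp_one_lt_d9) (by norm_num)
    linarith
  have hℒ₅0 : 0 < ℒ₅ := by linarith
  have hLqℒ₅ : Lq ≤ ℒ₅ := by rw [hℒ₅def]; linarith [Real.log_pos (by norm_num : (1:ℝ) < 5)]
  -- the package at height `0`
  obtain ⟨S, m, ψ, hS, hS', hψ, hψb⟩ := hpackage q χ hχ 0
  have hcen : (17 / 16 + ((0 : ℝ) : ℂ) * I : ℂ) = (17 / 16 : ℂ) := by simp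
  simp only [hcen, abs_zero, zero_add] at hS hS' hψ hψb
  have hψb' : ∀ z ∈ closedBall (17 / 16 : ℂ) (13 / 128), ‖ψ z‖ ≤ E * ℒ := by
    intro z hz; rw [hℒdef]; exact hψb z hz
  -- the horizontal distance `κ`
  set c' : ℝ := min (min cZ c) (1 / 8) with hc'def
  have hc'0 : 0 < c' := lt_min (lt_min hcZ hc) (by norm_num)
  have hc'Z : c' ≤ cZ := (min_le_left _ _).trans (min_le_left _ _)
  have hc'c : c' ≤ c := (min_le_left _ _).trans (min_le_right _ _)
  have hc'8 : c' ≤ 1 / 8 := min_le_right _ _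
  set κ : ℝ := c' / ℒ₅ with hκdef
  have hκ0 : 0 < κ := by positivity
  have hκ21 : κ ≤ 21 / 128 := by
    rw [hκdef]
    calc c' / ℒ₅ ≤ c' / 1 := div_le_div_of_nonneg_left hc'0.le one_pos hℒ₅1
      _ ≤ 21 / 128 := by rw [div_one]; linarith
  -- `1 ∉ S`, so `S.erase 1 = S`
  have h1S : (1 : ℂ) ∉ S := fun h1 ↦
    DirichletCharacter.LFunction_ne_zero_of_one_le_re χ (Or.inl hχ) (by simp) (hS 1 h1).1
  have hSe : S.erase 1 = S := Finset.erase_eq_of_notMem h1S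
  -- every zero of the package has `1 − Re a ≥ κ`
  have hfar : ∀ a ∈ S.erase 1, κ ≤ 1 - a.re := by
    intro a ha
    rw [hSe] at ha
    have hLa := (hS a ha).1
    have hanorm := (hS a ha).2.2
    rcases eq_or_ne a.im 0 with him | him
    · -- a real zero: the hypothesis
      have hare : a = ((a.re : ℝ) : ℂ) := by
        apply Complex.ext <;> simp [him]
      have hLa' : χ.LFunction (a.re : ℂ) = 0 := by rw [← hare]; exact hLa
      have ha1 : a.re < 1 := re_lt_one_of_zero χ hχ hLa
      have hale : a.re ≤ 1 - c / Lq := by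
        by_contra hcon
        exact hfree a.re (not_le.mp hcon) ha1 hLa'
      have : κ ≤ c / Lq := by
        rw [hκdef]
        calc c' / ℒ₅ ≤ c' / Lq := div_le_div_of_nonneg_left hc'0.le hLq0 hLqℒ₅
          _ ≤ c / Lq := div_le_div_of_nonneg_right hc'c hLq0.le
      linarith
    · -- a complex zero: the zero-free region
      have hale : a.re ≤ 1 - cZ / (Real.log q + Real.log (|a.im| + 4)) := by
        by_contra hcon
        exact him (hZF q χ hχ a hLa (not_le.mp hcon)).2
      have haim : |a.im| ≤ 1 := by
        have h1 : |(a - 17 / 16).im| ≤ ‖a - 17 / 16‖ := Complex.abs_im_le_norm _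
        have h2 : (a - 17 / 16 : ℂ).im = a.im := by simp
        rw [h2] at h1
        linarith
      have hlogim : Real.log (|a.im| + 4) ≤ Real.log 5 :=
        Real.log_le_log (by positivity) (by linarith)
      have hden : 0 < Real.log q + Real.log (|a.im| + 4) := by
        have := Real.log_pos (by linarith [abs_nonneg a.im] : (1:ℝ) < |a.im| + 4)
        show 0 < Lq + Real.log (|a.im| + 4)
        linarith
      have : κ ≤ cZ / (Real.log q + Real.log (|a.im| + 4)) := by
        rw [hκdef]
        calc c' / ℒ₅ ≤ c' / (Real.log q + Real.log (|a.im| + 4)) :=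
              div_le_div_of_nonneg_left hc'0.le hden (by show Lq + _ ≤ ℒ₅; rw [hℒ₅def]; linarith)
          _ ≤ cZ / (Real.log q + Real.log (|a.im| + 4)) :=
              div_le_div_of_nonneg_right hc'Z hden.le
      linarith
  -- the sum over the zeros at `σ = 1`
  have hsum := re_sum_erase_le χ hχ (hKχ q χ) hS hψ hψb' hκ0 hκ21 hfar
  rw [hSe] at hsum
  -- the identity at `1`
  have hone : ((1 : ℝ) : ℂ) = 1 := by simp
  have hid : deriv χ.LFunction 1 / χ.LFunction 1 = ψ 1 + ∑ a ∈ S, (m a : ℂ) / (1 - a) := by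
    have h := logDeriv_one_add_eq χ hχ hψ (u := 0) le_rfl (by norm_num)
    simpa only [add_zero, hone] using h
  have hψ1 : |(ψ 1).re| ≤ E * ℒ := by
    have := (Complex.abs_re_le_norm _).trans
      (hψb' _ (one_add_mem_closedBall (u := 0) le_rfl (by norm_num)))
    simpa only [add_zero, hone] using this
  -- bookkeeping of constants
  have hEℒ : E * ℒ ≤ 3 * E * Lq := by
    calc E * ℒ ≤ E * (3 * Lq) := mul_le_mul_of_nonneg_left hℒ3 hE
      _ = 3 * E * Lq := by ring
  have hK₀' : K₀ ≤ 2 * K₀ * Lq := by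
    calc K₀ = K₀ * 1 := (mul_one _).symm
      _ ≤ K₀ * (2 * Lq) := mul_le_mul_of_nonneg_left h2Lq hK₀
      _ = 2 * K₀ * Lq := by ring
  -- `1/c' ≤ 1/cZ + 1/c + 8`
  have hinvc' : 1 / c' ≤ 1 / cZ + 1 / c + 8 := by
    rw [hc'def]
    rcases le_total (min cZ c) (1 / 8) with h | h
    · rw [min_eq_left h]
      rcases le_total cZ c with h' | h'
      · rw [min_eq_left h']
        have : 0 ≤ 1 / c := by positivity
        linarith
      · rw [min_eq_right h']
        have : 0 ≤ 1 / cZ := by positivity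
        linarith
    · rw [min_eq_right h, one_div_one_div]
      have h1 : 0 ≤ 1 / cZ := by positivity
      have h2 : 0 ≤ 1 / c := by positivity
      linarith
  have hκ' : 1 / κ ≤ (1 / cZ + 1 / c + 8) * (4 * Lq) := by
    have hκinv : 1 / κ = ℒ₅ / c' := by rw [hκdef, one_div_div]
    rw [hκinv, div_eq_mul_one_div, mul_comm]
    exact mul_le_mul hinvc' hℒ₅4 hℒ₅0.le (by positivity)
  rw [hid, Complex.add_re]
  have hψ1' := le_abs_self (ψ 1).re
  have h8c : (1 / cZ + 1 / c + 8) * (4 * Lq) = 4 / cZ * Lq + 4 / c * Lq + 32 * Lq := by ring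
  rw [h8c] at hκ'
  have hrhs : (9 * E + 4 * K₀ + 8 / cZ + 64 + 1 + 8 / c) * Lq =
      9 * E * Lq + 4 * K₀ * Lq + 2 * (4 / cZ * Lq) + 2 * (4 / c * Lq) + 64 * Lq + Lq := by ring
  rw [hrhs]
  linarith [hsum, hψ1', hψ1, hEℒ, hκ', hK₀', hLq0.le]

/-! ## Packaged forms for `NoSiegelZeros` and `NoSiegelZerosOddQuadratic` -/

/-- Finitely many small moduli are harmless: for every `q₀` there is `B` with
`Re L'/L(1, χ) ≤ B log q` for all `2 ≤ q < q₀` and all Dirichlet characters `χ` mod `q` (a finite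
set of characters; `log q > 0`). [folklore] -/
theorem exists_forall_lt_logDeriv_le (q₀ : ℕ) :
    ∃ B : ℝ, ∀ (q : ℕ) [NeZero q], q < q₀ → 2 ≤ q → ∀ χ : DirichletCharacter ℂ q,
      (deriv χ.LFunction 1 / χ.LFunction 1).re ≤ B * Real.log q := by
  induction q₀ with
  | zero => exact ⟨0, fun q _ hq ↦ absurd hq (Nat.not_lt_zero q)⟩
  | succ n ih =>
    obtain ⟨B, hB⟩ := ih
    rcases lt_or_ge n 2 with hn | hn
    · exact ⟨B, fun q _ hq h2 χ ↦ hB q (by omega) h2 χ⟩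
    · haveI : NeZero n := ⟨by omega⟩
      -- the finitely many characters mod `n`
      set f : DirichletCharacter ℂ n → ℝ :=
        fun χ ↦ (deriv χ.LFunction 1 / χ.LFunction 1).re / Real.log n with hf
      have hfin : (Set.range f).Finite := Set.finite_range f
      obtain ⟨B', hB'⟩ := hfin.bddAbove
      refine ⟨max B B', fun q _ hq h2 χ ↦ ?_⟩
      have hq2 : (2 : ℝ) ≤ q := by exact_mod_cast h2
      have hLq0 : 0 < Real.log q := by
        have := Real.log_le_log two_pos hq2
        linarith [Real.log_two_gt_d9]
      rcases Nat.lt_succ_iff_lt_or_eq.mp hq with hlt | heq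
      · calc (deriv χ.LFunction 1 / χ.LFunction 1).re ≤ B * Real.log q := hB q hlt h2 χ
          _ ≤ max B B' * Real.log q := by gcongr; exact le_max_left _ _
      · subst heq
        have hmem : f χ ∈ Set.range f := Set.mem_range_self χ
        have hle : f χ ≤ B' := hB' hmem
        have hle' : (deriv χ.LFunction 1 / χ.LFunction 1).re / Real.log q ≤ max B B' :=
          hle.trans (le_max_right _ _)
        rwa [div_le_iff₀ hLq0] at hle'

/-- **No Siegel zeros for real primitive characters ⟸ `L'/L(1, χ) ≤ A log q`** (all `q ≥ 3`, all
quadratic primitive `χ` mod `q`): the hypothesis of `Literature.NumberTheory.LFunctions.NoSiegelZeros`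
(rh.S34) follows with `c = 1/(max A 0 + C₀)`. [cite: GranvilleStark2000, §1 and §3.1 Remark 1] -/
theorem noSiegelZeros_of_logDeriv_le
    (h : ∃ A : ℝ, ∀ (q : ℕ) [NeZero q], 3 ≤ q → ∀ χ : DirichletCharacter ℂ q, χ.IsQuadratic →
      χ.IsPrimitive → (deriv χ.LFunction 1 / χ.LFunction 1).re ≤ A * Real.log q) :
    NoSiegelZeros := by
  obtain ⟨C₀, hC₀, H⟩ := exists_LFunction_ne_zero_of_logDeriv_le
  obtain ⟨A, hA⟩ := h
  refine ⟨1 / (max A 0 + C₀), by positivity, fun q _ hq χ hquad hprim σ hσ ↦ ?_⟩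
  have hχ : χ ≠ 1 := fun h1 ↦ by
    have hc : χ.conductor = 1 := DirichletCharacter.eq_one_iff_conductor_eq_one.1 h1
    have hq' : χ.conductor = q := hprim
    omega
  have hχ2 : χ ^ 2 = 1 := hquad.sq_eq_one
  have hq3 : (3 : ℝ) ≤ q := by exact_mod_cast hq
  have hLq0 : 0 < Real.log q := Real.log_pos (by linarith)
  have hbound : (deriv χ.LFunction 1 / χ.LFunction 1).re ≤ max A 0 * Real.log q :=
    (hA q hq χ hquad hprim).trans (mul_le_mul_of_nonneg_right (le_max_left _ _) hLq0.le)
  refine H (max A 0) (le_max_right _ _) q χ hχ hχ2 (by omega)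
    (deriv_re_le_of_logDeriv_re_le χ hχ hχ2 hbound) σ ?_
  rwa [div_div] at hσ

/-- **Sufficiently large moduli suffice**: if `Re L'/L(1, χ) ≤ A log q` for all `q ≥ q₀` and all
quadratic primitive `χ` mod `q`, then `NoSiegelZeros` (the finitely many `3 ≤ q < q₀` are absorbed
by `exists_forall_lt_logDeriv_le`). [cite: GranvilleStark2000, §1 and §3.1 Remark 1] -/
theorem noSiegelZeros_of_eventually_logDeriv_le
    (h : ∃ A : ℝ, ∃ q₀ : ℕ, ∀ (q : ℕ) [NeZero q], q₀ ≤ q → 3 ≤ q → ∀ χ : DirichletCharacter ℂ q,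
      χ.IsQuadratic → χ.IsPrimitive →
        (deriv χ.LFunction 1 / χ.LFunction 1).re ≤ A * Real.log q) :
    NoSiegelZeros := by
  obtain ⟨A, q₀, hA⟩ := h
  obtain ⟨B, hB⟩ := exists_forall_lt_logDeriv_le q₀
  refine noSiegelZeros_of_logDeriv_le ⟨max A B, fun q _ hq χ hquad hprim ↦ ?_⟩
  have hq3 : (3 : ℝ) ≤ q := by exact_mod_cast hq
  have hLq0 : 0 < Real.log q := Real.log_pos (by linarith)
  rcases lt_or_ge q q₀ with hlt | hge
  · exact (hB q hlt (by omega) χ).trans (mul_le_mul_of_nonneg_right (le_max_right _ _) hLq0.le)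
  · exact (hA q hge hq χ hquad hprim).trans
      (mul_le_mul_of_nonneg_right (le_max_left _ _) hLq0.le)

/-- **The equivalence** (Granville–Stark §3.1 Remark 1; Táfula 2021, p. 3: "`|L'/L(1, χ_D)| ≪ log|D|`,
which is equivalent to `L(s, χ_D)` having no Siegel zeros"), for all real primitive characters:
`NoSiegelZeros ↔ ∃ A, ∀ q ≥ 3, ∀ χ` quadratic primitive mod `q`, `Re L'/L(1, χ) ≤ A log q`.
[cite: GranvilleStark2000, §3.1 Remark 1] -/
theorem noSiegelZeros_iff_logDeriv_le :
    NoSiegelZeros ↔ ∃ A : ℝ, ∀ (q : ℕ) [NeZero q], 3 ≤ q → ∀ χ : DirichletCharacter ℂ q,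
      χ.IsQuadratic → χ.IsPrimitive →
        (deriv χ.LFunction 1 / χ.LFunction 1).re ≤ A * Real.log q := by
  refine ⟨fun ⟨c, hc, hfree⟩ ↦ ?_, noSiegelZeros_of_logDeriv_le⟩
  obtain ⟨A₁, A₂, hA₁, hA₂, H⟩ := exists_logDeriv_le_of_LFunction_ne_zero
  refine ⟨A₁ + A₂ / min c 1, fun q _ hq χ hquad hprim ↦ ?_⟩
  have hχ : χ ≠ 1 := fun h1 ↦ by
    have hc : χ.conductor = 1 := DirichletCharacter.eq_one_iff_conductor_eq_one.1 h1
    have hq' : χ.conductor = q := hprim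
    omega
  have hq3 : (3 : ℝ) ≤ q := by exact_mod_cast hq
  have hLq0 : 0 < Real.log q := Real.log_pos (by linarith)
  refine H (min c 1) (lt_min hc one_pos) (min_le_right _ _) q χ hχ (by omega) fun σ hσ _ ↦ ?_
  refine hfree q hq χ hquad hprim σ (lt_of_le_of_lt ?_ hσ)
  gcongr
  exact min_le_left _ _

end Literature.NumberTheory.LFunctions.ExceptionalZero

end
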